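import Summits.ResolutionOfSingularities.ResolutionOfSingularities.Theorems.FrobeniusLadderFInjectiveMacaulayficationFHalfRowOfTwoStoreysCharts
import HarnessLib

/-!
# (W-TD) two-storey glue with the storey-2 centre ASSEMBLED FROM THREE CHARTS: J⁺ := (K~).map ι_U ⊓ (M₄~).map ι₄ ⊓ (M₅~).map ι₅ — no gluing, no saturation
# (crux `FInjectiveMacaulayfication` stmt-ResolutionOfSingularities-15315, chain w45a; res-L1-w45a-plan-1 RULINGS R21.25 (D) «J := K′𝒪 ∪ J‴₄ ∪ J‴₅ ∪ 𝒪», R21.26 (W1′),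
# R21.28 «row #8 kernel inputs all specified»; seat res-L1-w45a-stub-1 g13, DESIGN FINDING 21:24Z (F1)/(F2); GENERIC part = the final shape of row #8 `f4pos_rowD_twoStorey`
# modulo its data modules (storey 1 res-L1-w45a-stub-2; the three chart models, the overlap identities and the support routing res-L1-w45a-stub-3 / tri-2))

[OURS · L1 W4.5a] Support file (`--supports stmt-ResolutionOfSingularities-15315 --as helper`); def-free; UNCONDITIONAL; no named fact; NOT a statement of any manuscript.
Nothing of the crux is proved. AI-written (AI review is weaker than expert review).

★★★ `fHalfConclusion_of_threeCharts` — `X` integral Noetherian, `x ∈ X`; STOREY 1 `π₁ : X₁ → X` a blowing up along `Jτ·JK ≠ ⊥` (supports over `x`); three charts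
`ι_U : U → X₁`, `ι₄ : V₄ → X₁`, `ι₅ : V₅ → X₁` (open immersions, quasi-compact) carrying ideal sheaves `K ≠ ⊥`, `M₄`, `M₅` supported over the closure of `x`; the storey-2
centre is `J⁺ := (K.map ι_U) ⊓ (M₄.map ι₄) ⊓ (M₅.map ι₅)`. INPUTS: (o) four OVERLAP inequalities `K ≤ (M₄.map ι₄)|_U`, `K ≤ (M₅.map ι₅)|_U`, `M₄ ≤ (K.map ι_U)|_{V₄}`,
`M₅ ≤ (K.map ι_U)|_{V₅}` (by ✓ `comap_map_idealSheaf_of_charts` these are ideal inclusions in the two overlap rings); (m) three MODELS: every blowing up of `U` along `K`, of `V₄`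
along `M₄`, of `V₅` along `M₅` is FULL at every point; (T) SUPPORT ROUTING: every point of `Supp J⁺` lies in `ι_U(U)`, or in `ι₄(V₄ ∖ Supp (M₅.map ι₅)|_{V₄})`, or in
`ι₅(V₅ ∖ Supp (M₄.map ι₄)|_{V₅})`; (γ) `X₁` FULL at the points over a generization of `x` off `ι_U(Supp K)`. THEN `J⁺|_U = K`, `J⁺|_{V₄} = M₄ ⊓ N₄` with `N₄ = (M₅.map ι₅)|_{V₄}`
(so a blowing up along `J⁺` is, over `ι₄(V₄ ∖ Supp N₄)`, one along `M₄`), and the F-half's conclusion holds for every blowing up of `Spec 𝒪_{X,x}` along `Jτ·𝒪_{X,x}`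
(✓ p665204 `fHalfConclusion_of_twoStoreys_split` + ✓ p668755 + ✓ p670053). Affine first-storey form `fHalfConclusion_of_threeCharts_affine`.
[cite: StacksProject, Tag 080B and Tag 01OG] [cite: GortzWedhorn2020, Prop. 13.91 and (13.19)] [cite: Temkin2008, Lemma 2.1.4]
-/

-- single-problem summit: the doubled namespace component is forced
set_option linter.dupNamespace false

noncomputable section

namespace Summit.ResolutionOfSingularities.ResolutionOfSingularities.Theorems.FInjectiveMacaulayfication.FHalfRowOfTwoStoreys

open CategoryTheory CategoryTheory.Limits AlgebraicGeometry TopologicalSpace IsLocalRing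
open Literature.AlgebraicGeometry.Resolution
open Summit.ResolutionOfSingularities.ResolutionOfSingularities.Theorems.FInjectiveMacaulayfication
open SliceableCentre GermOfGlobalBlowup Scheme.IdealSheafData

universe u

/-! ## §1 Restrictions and support of the three-chart centre -/

/-- The support of an intersection of ideal sheaves lies in the union of the supports (`I·J ≤ I ⊓ J`). [folklore] -/
theorem support_inf_le {Y : Scheme.{u}} (I J : Y.IdealSheafData) :
    ((I ⊓ J).support : Set Y) ⊆ (I.support : Set Y) ∪ (J.support : Set Y) := by
  intro y hy
  have hle : I * J ≤ I ⊓ J := by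
    refine le_inf (fun V => ?_) (fun V => ?_)
    · change (I * J).ideal V ≤ I.ideal V
      rw [ideal_mul, Pi.mul_apply]
      exact Ideal.mul_le_right
    · change (I * J).ideal V ≤ J.ideal V
      rw [ideal_mul, Pi.mul_apply]
      exact Ideal.mul_le_left
  have h := support_antitone (X := Y) hle hy
  rw [support_mul] at h
  exact h

/-- `ι(Supp K) ⊆ Supp (K.map ι)` (the support of the largest extension is the closure). [folklore] -/
theorem image_support_subset_support_map {U Y : Scheme.{u}} (ι : U ⟶ Y) [QuasiCompact ι] (K : U.IdealSheafData) :
    (fun u : U => ι.base u) '' (K.support : Set U) ⊆ ((K.map ι).support : Set Y) := by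
  intro y hy
  have : y ∈ closure ((fun u : U => ι.base u) '' (K.support : Set U)) := subset_closure hy
  rw [support_map]
  exact this

/-- **`J⁺|_U = K`.** [folklore] -/
theorem threeCharts_comap_U {U V₄ V₅ Y : Scheme.{u}} (ιU : U ⟶ Y) [IsOpenImmersion ιU] [QuasiCompact ιU] (ι₄ : V₄ ⟶ Y) (ι₅ : V₅ ⟶ Y)
    (K : U.IdealSheafData) (M₄ : V₄.IdealSheafData) (M₅ : V₅.IdealSheafData)
    (hU₄ : K ≤ (M₄.map ι₄).comap ιU) (hU₅ : K ≤ (M₅.map ι₅).comap ιU) :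
    ((K.map ιU) ⊓ (M₄.map ι₄) ⊓ (M₅.map ι₅)).comap ιU = K := by
  rw [comap_inf_of_isOpenImmersion, comap_inf_of_isOpenImmersion, comap_map_of_isOpenImmersion]
  exact le_antisymm (inf_le_left.trans inf_le_left) (le_inf (le_inf le_rfl hU₄) hU₅)

/-- **`J⁺|_{V₄} = M₄ ⊓ (M₅.map ι₅)|_{V₄}`.** [folklore] -/
theorem threeCharts_comap_V₄ {U V₄ V₅ Y : Scheme.{u}} (ιU : U ⟶ Y) (ι₄ : V₄ ⟶ Y) [IsOpenImmersion ι₄] [QuasiCompact ι₄] (ι₅ : V₅ ⟶ Y)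
    (K : U.IdealSheafData) (M₄ : V₄.IdealSheafData) (M₅ : V₅.IdealSheafData) (h₄U : M₄ ≤ (K.map ιU).comap ι₄) :
    ((K.map ιU) ⊓ (M₄.map ι₄) ⊓ (M₅.map ι₅)).comap ι₄ = M₄ ⊓ (M₅.map ι₅).comap ι₄ := by
  rw [comap_inf_of_isOpenImmersion, comap_inf_of_isOpenImmersion, comap_map_of_isOpenImmersion, inf_eq_right.mpr h₄U]

/-- **`J⁺|_{V₅} = M₅ ⊓ (M₄.map ι₄)|_{V₅}`.** [folklore] -/
theorem threeCharts_comap_V₅ {U V₄ V₅ Y : Scheme.{u}} (ιU : U ⟶ Y) (ι₄ : V₄ ⟶ Y) (ι₅ : V₅ ⟶ Y) [IsOpenImmersion ι₅] [QuasiCompact ι₅]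
    (K : U.IdealSheafData) (M₄ : V₄.IdealSheafData) (M₅ : V₅.IdealSheafData) (h₅U : M₅ ≤ (K.map ιU).comap ι₅) :
    ((K.map ιU) ⊓ (M₄.map ι₄) ⊓ (M₅.map ι₅)).comap ι₅ = M₅ ⊓ (M₄.map ι₄).comap ι₅ := by
  rw [comap_inf_of_isOpenImmersion, comap_inf_of_isOpenImmersion, comap_map_of_isOpenImmersion]
  exact le_antisymm (le_inf inf_le_right (inf_le_left.trans inf_le_right))
    (le_inf (le_inf (inf_le_left.trans h₅U) inf_le_right) inf_le_left)

/-! ## §2 ★★★ The three-chart two-storey glue -/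

/-- ★★★ **TWO-STOREY GLUE WITH A THREE-CHART CENTRE.** See the module docstring. [cite: StacksProject, Tag 080B and Tag 01OG] [cite: GortzWedhorn2020, Prop. 13.91] -/
theorem fHalfConclusion_of_threeCharts (p : ℕ) {X X₁ U V₄ V₅ : Scheme.{0}} [IsIntegral X] [IsNoetherian X] (x : X)
    {π₁ : X₁ ⟶ X} {Jτ JK : X.IdealSheafData} (hπ₁ : IsBlowup π₁ (Jτ * JK)) (hJ : Jτ * JK ≠ ⊥)
    (hsuppτ : ∀ y ∈ (Jτ.support : Set X), y ⤳ x → y = x) (hsuppK : ∀ y ∈ (JK.support : Set X), y ⤳ x → y = x)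
    (ιU : U ⟶ X₁) [IsOpenImmersion ιU] [QuasiCompact ιU] (ι₄ : V₄ ⟶ X₁) [IsOpenImmersion ι₄] [QuasiCompact ι₄]
    (ι₅ : V₅ ⟶ X₁) [IsOpenImmersion ι₅] [QuasiCompact ι₅]
    (K : U.IdealSheafData) (hK : K ≠ ⊥) (M₄ : V₄.IdealSheafData) (M₅ : V₅.IdealSheafData)
    (hsuppKx : ∀ u ∈ (K.support : Set U), x ⤳ π₁.base (ιU.base u))
    (hsupp₄x : ∀ v ∈ (M₄.support : Set V₄), x ⤳ π₁.base (ι₄.base v))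
    (hsupp₅x : ∀ v ∈ (M₅.support : Set V₅), x ⤳ π₁.base (ι₅.base v))
    -- (o) overlap inequalities
    (hU₄ : K ≤ (M₄.map ι₄).comap ιU) (hU₅ : K ≤ (M₅.map ι₅).comap ιU)
    (h₄U : M₄ ≤ (K.map ιU).comap ι₄) (h₅U : M₅ ≤ (K.map ιU).comap ι₅)
    -- (m) models
    (hαU : ∀ (W : Scheme.{0}) (ρ : W ⟶ U), IsBlowup ρ K → ∀ w : W, FullCl p (W.presheaf.stalk w))
    (hα₄ : ∀ (W : Scheme.{0}) (ρ : W ⟶ V₄), IsBlowup ρ M₄ → ∀ w : W, FullCl p (W.presheaf.stalk w))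
    (hα₅ : ∀ (W : Scheme.{0}) (ρ : W ⟶ V₅), IsBlowup ρ M₅ → ∀ w : W, FullCl p (W.presheaf.stalk w))
    -- (T) support routing
    (hT : ∀ y ∈ ((((K.map ιU) ⊓ (M₄.map ι₄) ⊓ (M₅.map ι₅))).support : Set X₁),
      y ∈ Set.range (fun u : U => ιU.base u) ∨
      y ∈ (fun v : V₄ => ι₄.base v) '' ((((M₅.map ι₅).comap ι₄).support : Set V₄)ᶜ) ∨
      y ∈ (fun v : V₅ => ι₅.base v) '' ((((M₄.map ι₄).comap ι₅).support : Set V₅)ᶜ))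
    -- (γ) storey 1 off the chart centre
    (hγ : ∀ x₁ : X₁, x₁ ∉ (fun u : U => ιU.base u) '' (K.support : Set U) → π₁.base x₁ ⤳ x → FullCl p (X₁.presheaf.stalk x₁)) :
    ∀ (S' : Scheme.{0}) (g : S' ⟶ Spec (X.presheaf.stalk x)), IsBlowup g (Jτ.comap (X.fromSpecStalk x)) →
      ∃ 𝓚 : S'.IdealSheafData, 𝓚 ≠ ⊥ ∧ (∀ s ∈ (𝓚.support : Set S'), g.base s = closedPoint (X.presheaf.stalk x)) ∧
        ∀ (S'' : Scheme.{0}) (π : S'' ⟶ S'), IsBlowup π 𝓚 → ∀ s : S'', FullCl p (S''.presheaf.stalk s) := by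
  set J : X₁.IdealSheafData := (K.map ιU) ⊓ (M₄.map ι₄) ⊓ (M₅.map ι₅) with hJdef
  -- restrictions
  have hJU : J.comap ιU = K := threeCharts_comap_U ιU ι₄ ι₅ K M₄ M₅ hU₄ hU₅
  have hJ₄ : J.comap ι₄ = M₄ ⊓ (M₅.map ι₅).comap ι₄ := threeCharts_comap_V₄ ιU ι₄ ι₅ K M₄ M₅ h₄U
  have hJ₅ : J.comap ι₅ = M₅ ⊓ (M₄.map ι₄).comap ι₅ := threeCharts_comap_V₅ ιU ι₄ ι₅ K M₄ M₅ h₅U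
  -- non-zero
  have hJne : J ≠ ⊥ := by
    intro h0
    apply hK
    rw [← hJU, h0, Scheme.IdealSheafData.comap_bot]
  -- support over `x`
  have hsuppJ : ∀ y ∈ (J.support : Set X₁), π₁.base y ⤳ x → π₁.base y = x := by
    intro y hy hyx
    rcases support_inf_le _ _ hy with hy' | hy5
    · rcases support_inf_le _ _ hy' with hyK | hy4
      · exact support_map_generization ιU K π₁ x hsuppKx y hyK hyx
      · exact support_map_generization ι₄ M₄ π₁ x hsupp₄x y hy4 hyx
    · exact support_map_generization ι₅ M₅ π₁ x hsupp₅x y hy5 hyx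
  -- STOREY 2: any blowing up of `X₁` along `J`
  obtain ⟨X₂, π₂, hπ₂⟩ := exists_isBlowup X₁ J
  refine fHalfConclusion_of_twoStoreys_split p x hπ₁ hJ hsuppτ hsuppK hπ₂ hJne hsuppJ (fun x₂ hx₂ => ?_) (fun x₁ hx₁ hx₁x => ?_)
  · -- (α) over `Supp J`: route through the three charts
    rcases hT _ hx₂ with hU | h4 | h5
    · refine fullCl_of_isBlowup_of_chart p ιU J hπ₂ Set.univ (fun W ρ hρ w _ => ?_) x₂ ?_
      · rw [hJU] at hρ
        exact hαU W ρ hρ w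
      · obtain ⟨u, hu⟩ := hU
        exact ⟨u, Set.mem_univ u, hu⟩
    · refine fullCl_of_isBlowup_of_chart p ι₄ J hπ₂ _ (fun W ρ hρ w hw => ?_) x₂ h4
      rw [hJ₄] at hρ
      exact fullCl_of_isBlowup_inf_off_support p M₄ _ hα₄ hρ w hw
    · refine fullCl_of_isBlowup_of_chart p ι₅ J hπ₂ _ (fun W ρ hρ w hw => ?_) x₂ h5
      rw [hJ₅] at hρ
      exact fullCl_of_isBlowup_inf_off_support p M₅ _ hα₅ hρ w hw
  · -- (γ) off `Supp J ⊇ ι_U(Supp K)`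
    refine hγ x₁ (fun hmem => hx₁ ?_) hx₁x
    have h1 : x₁ ∈ ((K.map ιU).support : Set X₁) := image_support_subset_support_map ιU K hmem
    exact support_antitone (X := X₁) (show J ≤ K.map ιU from inf_le_left.trans inf_le_left) h1

/-- ★★★ **AFFINE FIRST-STOREY FORM** (the shape of row #8 `f4pos_rowD_twoStorey`): `X = Spec A` (`A` a Noetherian domain), `π₁ = affineBlowup.π (τ * K₁)` with `v ⊆ √τ`,
`v ⊆ √K₁`; three charts of `affineBlowup (τ * K₁)` with centre pieces `K, M₄, M₅` over `v`; inputs (o) (m) (T) (γ) as in `fHalfConclusion_of_threeCharts`.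
[cite: StacksProject, Tag 080B] [cite: GortzWedhorn2020, (13.19)] -/
theorem fHalfConclusion_of_threeCharts_affine (p : ℕ) {A : Type} [CommRing A] [IsDomain A] [IsNoetherianRing A] (τ K₁ : Ideal A) (hτ : τ ≠ ⊥) (hK₁ : K₁ ≠ ⊥)
    (v : Spec (.of A)) (hvτ : v.asIdeal ≤ τ.radical) (hvK : v.asIdeal ≤ K₁.radical)
    {U V₄ V₅ : Scheme.{0}}
    (ιU : U ⟶ affineBlowup (τ * K₁)) [IsOpenImmersion ιU] [QuasiCompact ιU] (ι₄ : V₄ ⟶ affineBlowup (τ * K₁)) [IsOpenImmersion ι₄] [QuasiCompact ι₄]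
    (ι₅ : V₅ ⟶ affineBlowup (τ * K₁)) [IsOpenImmersion ι₅] [QuasiCompact ι₅]
    (K : U.IdealSheafData) (hK : K ≠ ⊥) (M₄ : V₄.IdealSheafData) (M₅ : V₅.IdealSheafData)
    (hsuppKx : ∀ u ∈ (K.support : Set U), v ⤳ (affineBlowup.π (τ * K₁)).base (ιU.base u))
    (hsupp₄x : ∀ w ∈ (M₄.support : Set V₄), v ⤳ (affineBlowup.π (τ * K₁)).base (ι₄.base w))
    (hsupp₅x : ∀ w ∈ (M₅.support : Set V₅), v ⤳ (affineBlowup.π (τ * K₁)).base (ι₅.base w))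
    (hU₄ : K ≤ (M₄.map ι₄).comap ιU) (hU₅ : K ≤ (M₅.map ι₅).comap ιU)
    (h₄U : M₄ ≤ (K.map ιU).comap ι₄) (h₅U : M₅ ≤ (K.map ιU).comap ι₅)
    (hαU : ∀ (W : Scheme.{0}) (ρ : W ⟶ U), IsBlowup ρ K → ∀ w : W, FullCl p (W.presheaf.stalk w))
    (hα₄ : ∀ (W : Scheme.{0}) (ρ : W ⟶ V₄), IsBlowup ρ M₄ → ∀ w : W, FullCl p (W.presheaf.stalk w))
    (hα₅ : ∀ (W : Scheme.{0}) (ρ : W ⟶ V₅), IsBlowup ρ M₅ → ∀ w : W, FullCl p (W.presheaf.stalk w))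
    (hT : ∀ y ∈ ((((K.map ιU) ⊓ (M₄.map ι₄) ⊓ (M₅.map ι₅))).support : Set ↥(affineBlowup (τ * K₁))),
      y ∈ Set.range (fun u : U => ιU.base u) ∨
      y ∈ (fun w : V₄ => ι₄.base w) '' ((((M₅.map ι₅).comap ι₄).support : Set V₄)ᶜ) ∨
      y ∈ (fun w : V₅ => ι₅.base w) '' ((((M₄.map ι₄).comap ι₅).support : Set V₅)ᶜ))
    (hγ : ∀ x₁ : ↥(affineBlowup (τ * K₁)), x₁ ∉ (fun u : U => ιU.base u) '' (K.support : Set U) → (affineBlowup.π (τ * K₁)).base x₁ ⤳ v →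
      FullCl p ((affineBlowup (τ * K₁)).presheaf.stalk x₁)) :
    ∀ (S' : Scheme.{0}) (g : S' ⟶ Spec ((Spec (.of A)).presheaf.stalk v)),
      IsBlowup g ((affineBlowup.idealSheaf τ).comap ((Spec (.of A)).fromSpecStalk v)) →
      ∃ 𝓚 : S'.IdealSheafData, 𝓚 ≠ ⊥ ∧ (∀ s ∈ (𝓚.support : Set S'), g.base s = closedPoint ((Spec (.of A)).presheaf.stalk v)) ∧
        ∀ (S'' : Scheme.{0}) (π : S'' ⟶ S'), IsBlowup π 𝓚 → ∀ s : S'', FullCl p (S''.presheaf.stalk s) := by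
  have hπ : IsBlowup (affineBlowup.π (τ * K₁)) (affineBlowup.idealSheaf τ * affineBlowup.idealSheaf K₁) := by
    rw [← affineBlowup.idealSheaf_mul]
    exact affineBlowup.isBlowup (τ * K₁)
  have hJ : affineBlowup.idealSheaf τ * affineBlowup.idealSheaf K₁ ≠ ⊥ := by
    rw [← affineBlowup.idealSheaf_mul]
    exact affineBlowup.idealSheaf_ne_bot (mul_ne_zero hτ hK₁)
  have hsupp : ∀ (L : Ideal A), v.asIdeal ≤ L.radical → ∀ y ∈ ((affineBlowup.idealSheaf L).support : Set (Spec (.of A))), y ⤳ v → y = v := by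
    intro L hvL y hy hyv
    rw [affineBlowup.support_idealSheaf] at hy
    have hLy : L ≤ y.asIdeal := fun a ha => hy ha
    have h1 : v.asIdeal ≤ y.asIdeal := hvL.trans (y.2.radical_le_iff.mpr hLy)
    have h2 : y.asIdeal ≤ v.asIdeal := (PrimeSpectrum.le_iff_specializes y v).mpr hyv
    exact PrimeSpectrum.ext (le_antisymm h2 h1)
  exact fHalfConclusion_of_threeCharts p v hπ hJ (hsupp τ hvτ) (hsupp K₁ hvK) ιU ι₄ ι₅ K hK M₄ M₅ hsuppKx hsupp₄x hsupp₅x hU₄ hU₅ h₄U h₅U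
    hαU hα₄ hα₅ hT hγ

end Summit.ResolutionOfSingularities.ResolutionOfSingularities.Theorems.FInjectiveMacaulayfication.FHalfRowOfTwoStoreys

end
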